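import Summits.HodgeConjecture.HodgeConjecture.Theorems.F0P6aSpecOrgansTBlockT5
import Summits.HodgeConjecture.HodgeConjecture.Theorems.F0P6aSpecialFibrePointsRows
import HarnessLib

/-!
# `F0P6aSpecOrgansTTranslReduction` — ★ RE-HOME of `Lines/F0_P6a_SpecOrgansT.lean` (tree sha16 8dca47ee93439c08, 1023 l.), PART 2 of 4 — tree lines :340–:648
See PART 1 `Theorems/F0P6aSpecOrgansTBlockT5.lean` for the full ★ re-home header and the original module docstring (verbatim there).  Same namespace (every
fully-qualified name unchanged); the scopes open at the cut are re-opened below with their `variable` ∕ `open` ∕ `set_option` ∕ `universe` lines replayed verbatim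
from the tree, in order; the code after the replay block is the tree bytes :340–:648, untouched.  HC_CM is proved only modulo the 7 printed citations (2 remaining: hLiu418 = stmt-HodgeConjecture-24832, h413 = stmt-HodgeConjecture-24833) until rung 0 closes; a re-home is count-neutral.
-/

-- ── replay of the scopes open at tree line :340 (verbatim) ──
set_option autoImplicit false
set_option linter.dupNamespace false
noncomputable section
universe u
namespace Summit.HodgeConjecture.HodgeConjecture.Cruxes.HLiu418.F0P6aLineSpecialisation
section Block_T5
open CategoryTheory CategoryTheory.Limits NumberField IsDedekindDomain MulAction AlgebraicGeometry
open scoped Matrix Polynomial Pointwise MonoidalCategory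
open Literature.NumberTheory.GaloisRepresentations
open Literature.NumberTheory.Automorphic Literature.NumberTheory.Automorphic.UnitaryGroup
open Literature.AlgebraicGeometry.ShimuraVarieties.UnitaryCanonicalModel
open Literature.NumberTheory.Automorphic.Liu2021.AppendixC
open Literature.AlgebraicGeometry.Motives (AlgPoints IntegralModel SchemeOver thickening thickeningGalAction thickeningLift specOver)
open Literature.NumberTheory.DiophantineGeometry (geomResidueField specialFibreFunctor specResidueField)
open Literature.NumberTheory.EllipticCurves (specGenericPoint)
open Literature.AlgebraicGeometry.RelativeSpec (ActionOver)
open Literature.AlgebraicGeometry.AbelianSchemes Literature.AlgebraicGeometry.AbelianSchemes.AbelianSchemeOver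
open Summit.HodgeConjecture.HodgeConjecture.Cruxes.HLiu418.F0P6aModuliDatumDefs
open Summit.HodgeConjecture.HodgeConjecture.Cruxes.HLiu418.F0P6aRGDAssembly
open Summit.HodgeConjecture.HodgeConjecture.Cruxes.HLiu418.F0P6aDatumOfInputs
section TranslReduction
open scoped MonObj CategoryTheory.Obj
variable {F : Type} [Field F] [NumberField F] [IsCMField F] {ι₁ : F →+* ℂ}
    {Jstar : Matrix (Fin 2) (Fin 2) F}
    {K₀ : C5.OpenCompactSubgroup ↥(finAdelic ↥(maximalRealSubfield F) F (IsCMField.complexConj F) 2 Jstar)}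
    {S : RecordSystemGS F Jstar ι₁ K₀} {hU7ₛ : S.HeckeTranslateDefinedOver}
    {hJ : (Jstar.map (IsCMField.complexConj F))ᵀ = Jstar} {hJu : IsUnit Jstar}
    {Fi : Type} [Field Fi] [Algebra F Fi] {Kc : C5.SmallLevel K₀} {G : Type} [Group G]
    {𝓜 : IntegralModel (𝓞 F) F ((thickening F Fi).obj (S.M.obj Kc))}
    {w : HeightOneSpectrum (𝓞 F)} {hw : (IsCMField.complexConj F) • w ≠ w} {h𝓨 : (𝓜.localise w).IsSmoothProper 1}
    {θ : ActionOver (𝓜.localise w).total.hom ((Fi ≃ₐ[F] Fi) × G)}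
    {e : Fi →ₐ[F] AlgebraicClosure (w.adicCompletion F)}

set_option maxHeartbeats 400000 in
set_option backward.isDefEq.respectTransparency false in
/-- **(C5) `exists_translReduction` — THE TRANSLATE REDUCTION AT `K₂`, (α)-CURRENCY** (producer of the hypothesis of §3b (C4), LA6-p01 (g2), re-stated in the D-line's
special-fibre carriers per LA2-plan (g0) 06:49:55Z).  From `RoofLink₂ I translΩ` (the generic roof `A_y —q→ B ←c— A_{translΩ y}` through the WHOLE `𝔭_{c•w}`-torsion,
D-LINE :290) there are an ideal `𝔞` and scalars `m`, `N′` (`N′` prime to the level `I.N`; road (γ): `𝔞 = p·𝔭_{c•w}·𝔭_w⁻¹`, `m = p²`, `N′ = p`) such that for EVERY `y` the composite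
`v := q ≫ d_p` REDUCES (★ (ν8k) `exists_specialFibre_hom_reduction_ker_ringAction`) to a homomorphism `r : A_{red₀ y} → A_{red₀ (translΩ y)}` of the special fibres
(`A_x̄ := sch₀Of 𝓜 w I.univ x̄`), FINITE and SURJECTIVE, with (KER) `Ker r = A_{red₀ y}[𝔞]` on ALL `T`-points (★ (ν8k) (v′)), (SIM) `r^*λ_{red₀ transl y} = m·λ_{red₀ y}` (★ (ν8k) (iv)),
(ACT) `𝒪_F`-equivariance in the `act₀Of` currency of `Roof₀` (★ (ν8k) (ii-ι), `(act₀Of …).hom.hom.hom` is `((I.act.baseChange π_s).baseChange x̄.left).i a` by `rfl`), (LVL)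
`r(σ^i(red₀ y)) = σ^i(red₀ transl y)^{N′}` on level POINTS (★ (ν8k) (iii) with `τ″ := τ^{N′}`; the `lvlPt₀Of` currency of `Roof₀` (r5₀)).  PROOF (LA2-p01 (g2)): `(p) = 𝔭_w·𝔮`
(`p ∈ 𝔭_w`, Dedekind), `𝔞 := 𝔭_{c•w}·𝔮` presented by ★ `exists_serrePresentation_of_ideal`, `m := p·p`, `N′ := p` (prime to `I.N` by `hpN`), and §2 at every `y` on the `RoofLink₂` package.
[cite: SerreTate1968, §1 Lemma 2] [cite: MumfordAV1970, §23 Thm. 2 (p. 231); §15 Thm. 1 (p. 143); §7 Thm. 4 (p. 72)] [cite: BoschLutkebohmertRaynaud1990, §7.3 Prop. 6 (p. 180)]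
[cite: Liu2021, Prop. D.8 p. 135] -/
theorem exists_translReduction (I : RGDInputsAt F ι₁ Jstar K₀ S hU7ₛ hJ hJu Fi Kc G 𝓜 w hw h𝓨 θ e)
    (translΩ : AlgPoints (S.M.obj Kc) (AlgebraicClosure (w.adicCompletion F)) → AlgPoints (S.M.obj Kc) (AlgebraicClosure (w.adicCompletion F)))
    (hroof₂ : RoofLink₂ I translΩ) (hpN : Nat.Coprime I.pChar I.N) :
    ∃ (𝔞 : Ideal (𝓞 F)) (m N' : ℕ), Nat.Coprime N' I.N ∧
      ∀ y : AlgPoints (S.M.obj Kc) (AlgebraicClosure (w.adicCompletion F)),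
        ∃ (r : (sch₀Of 𝓜 w I.univ (red₀Of S Kc 𝓜 w h𝓨 e y)).X ⟶ (sch₀Of 𝓜 w I.univ (red₀Of S Kc 𝓜 w h𝓨 e (translΩ y))).X) (_ : IsMonHom r)
          (_ : IsFinite r.left) (_ : Surjective r.left),
          -- (KER) `Ker r = A_{red₀ y}[𝔞]` on ALL `T`-points
          (∀ ⦃T : SchemeOver (geomResidueField w)⦄ (t : T ⟶ (sch₀Of 𝓜 w I.univ (red₀Of S Kc 𝓜 w h𝓨 e y)).X),
              t ≫ r = 1 ↔ ∀ a ∈ 𝔞, t ≫ (act₀Of 𝓜 w I.univ I.act a (red₀Of S Kc 𝓜 w h𝓨 e y)).hom.hom.hom = 1) ∧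
          -- (SIM) `r^* λ_{red₀ transl y} = m • λ_{red₀ y}`
          r ≫ (pol₀Of 𝓜 w I.univ I.pol (red₀Of S Kc 𝓜 w h𝓨 e (translΩ y))).lam ≫
              DualPair.dualIsogenyOver r (dual₀Of 𝓜 w I.univ I.dual (red₀Of S Kc 𝓜 w h𝓨 e y)) (dual₀Of 𝓜 w I.univ I.dual (red₀Of S Kc 𝓜 w h𝓨 e (translΩ y))) =
            (pol₀Of 𝓜 w I.univ I.pol (red₀Of S Kc 𝓜 w h𝓨 e y)).lam ≫ (dual₀Of 𝓜 w I.univ I.dual (red₀Of S Kc 𝓜 w h𝓨 e y)).hat.mulN m ∧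
          -- (ACT) `𝒪_F`-equivariance
          (∀ a : 𝓞 F, (act₀Of 𝓜 w I.univ I.act a (red₀Of S Kc 𝓜 w h𝓨 e y)).hom.hom.hom ≫ r =
              r ≫ (act₀Of 𝓜 w I.univ I.act a (red₀Of S Kc 𝓜 w h𝓨 e (translΩ y))).hom.hom.hom) ∧
          -- (LVL) level points: `r(σ^i(red₀ y)) = σ^i(red₀ transl y) ^ N′`
          (∀ i : Fin I.g ⊕ Fin I.g → ZMod I.N,
              (AlgPoints.map r (lvlPt₀Of 𝓜 w I.univ I.lvl (red₀Of S Kc 𝓜 w h𝓨 e y) i) :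
                  (fibre₀Of 𝓜 w I.univ (red₀Of S Kc 𝓜 w h𝓨 e (translΩ y))).Points (geomResidueField w)) =
                lvlPt₀Of 𝓜 w I.univ I.lvl (red₀Of S Kc 𝓜 w h𝓨 e (translΩ y)) i ^ N') := by
  -- `(p) = 𝔭_w · 𝔮`
  have hp𝔭 : ((I.pChar : ℕ) : 𝓞 F) ∈ w.asIdeal := I.hpChar.2
  obtain ⟨𝔮, hpq⟩ : w.asIdeal ∣ Ideal.span {(I.pChar : 𝓞 F)} :=
    Ideal.dvd_iff_le.mpr ((Ideal.span_singleton_le_iff_mem _).mpr hp𝔭)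
  -- a Serre presentation of `𝔞 := 𝔭_{c•w} · 𝔮` (`𝔮 ≠ 0` since `p ≠ 0`)
  have h𝔮 : 𝔮 ≠ ⊥ := by
    rintro rfl
    rw [Ideal.mul_bot] at hpq
    exact I.hpChar.1.ne_zero (by exact_mod_cast (Ideal.span_singleton_eq_bot.mp hpq))
  have h𝔞 : ((IsCMField.complexConj F) • w).asIdeal * 𝔮 ≠ ⊥ := fun h =>
    (Ideal.mul_eq_bot.mp h).elim ((IsCMField.complexConj F) • w).ne_bot h𝔮
  obtain ⟨m, E, hE, Pm, Qm, N, hN, hP, hQ, hQP, hPQ, hspan, -, -⟩ :=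
    Literature.NumberTheory.NumberFields.SerrePresentation.exists_serrePresentation_of_ideal _ h𝔞
  refine ⟨((IsCMField.complexConj F) • w).asIdeal * 𝔮, I.pChar * I.pChar, I.pChar, hpN, fun y => ?_⟩
  exact (hroof₂ y).elim fun K₂ hK => exists_translReduction_at I y (translΩ y) K₂ hK.1 hK.2 𝔮 hpq.symm E hE Pm Qm hN hP hQ hQP hPQ hspan

end TranslReduction

end Block_T5

/-! ## §Tα — (C1α)∕(C3a)∕(C3α) + (C4α)∕(T-WD) — LA6-p01 (g3) `LineSpecialisation.sec3b.alpha.v3` ed9770d7ba6ae4f3 `section CommonSourceAlpha` (MINUS `eq_of_pow_eq_pow_of_coprime`, now ★ — lesson 10; v1 leg GREEN with the drop) + `section TranslWDα` (byte-identical); its own `section TranslReduction` copy of §T5 DROPPED — §T5 above is the home -/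

section Block_Tα

open CategoryTheory CategoryTheory.Limits NumberField IsDedekindDomain MulAction AlgebraicGeometry
open scoped Matrix Polynomial Pointwise MonoidalCategory
open Literature.NumberTheory.GaloisRepresentations
open Literature.NumberTheory.Automorphic Literature.NumberTheory.Automorphic.UnitaryGroup
open Literature.AlgebraicGeometry.ShimuraVarieties.UnitaryCanonicalModel
open Literature.NumberTheory.Automorphic.Liu2021.AppendixC
open Literature.AlgebraicGeometry.Motives (AlgPoints IntegralModel SchemeOver thickening thickeningGalAction thickeningLift specOver)
open Literature.NumberTheory.DiophantineGeometry (geomResidueField specialFibreFunctor specResidueField)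
open Literature.NumberTheory.EllipticCurves (specGenericPoint)
open Literature.AlgebraicGeometry.RelativeSpec (ActionOver)
open Literature.AlgebraicGeometry.AbelianSchemes Literature.AlgebraicGeometry.AbelianSchemes.AbelianSchemeOver
open Literature.AlgebraicGeometry.GroupSchemes.AffineGroupScheme (Alg quotIncl)
open Summit.HodgeConjecture.HodgeConjecture.Cruxes.HLiu418.F0P6aModuliDatumDefs
open Summit.HodgeConjecture.HodgeConjecture.Cruxes.HLiu418.F0P6aRGDAssembly
open Summit.HodgeConjecture.HodgeConjecture.Cruxes.HLiu418.F0P6aDatumOfInputs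

section CommonSourceAlpha

open scoped MonObj CategoryTheory.Obj

-- the frame of the D-line՚s `Letters` section VERBATIM
variable {F : Type} [Field F] [NumberField F] [IsCMField F] {ι₁ : F →+* ℂ}
    {Jstar : Matrix (Fin 2) (Fin 2) F}
    {K₀ : C5.OpenCompactSubgroup ↥(finAdelic ↥(maximalRealSubfield F) F (IsCMField.complexConj F) 2 Jstar)}
    {S : RecordSystemGS F Jstar ι₁ K₀} {hU7ₛ : S.HeckeTranslateDefinedOver}
    {hJ : (Jstar.map (IsCMField.complexConj F))ᵀ = Jstar} {hJu : IsUnit Jstar}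
    {Fi : Type} [Field Fi] [Algebra F Fi] {Kc : C5.SmallLevel K₀} {G : Type} [Group G]
    {𝓜 : IntegralModel (𝓞 F) F ((thickening F Fi).obj (S.M.obj Kc))}
    {w : HeightOneSpectrum (𝓞 F)} {hw : (IsCMField.complexConj F) • w ≠ w} {h𝓨 : (𝓜.localise w).IsSmoothProper 1}
    {θ : ActionOver (𝓜.localise w).total.hom ((Fi ≃ₐ[F] Fi) × G)}
    {e : Fi →ₐ[F] AlgebraicClosure (w.adicCompletion F)}

set_option maxHeartbeats 400000 in
set_option backward.isDefEq.respectTransparency false in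
/-- **(C1α) `red₀Of_eq_of_structuredIso₀` — A STRUCTURED ISOMORPHISM OF THE SPECIAL FIBRES `A_{red₀ z₁} ≅ A_{red₀ z₂}` FORCES `red₀ z₁ = red₀ z₂`** ((α)-currency twin of v5 (C1)
`red₀Of_eq_of_structuredIso_special`).  For two points `z₁ z₂` of the `e`-sheet with reductions `x̄ᵢ := red₀Of … zᵢ`, an isomorphism of `κ̄(w)`-group schemes
`ε : (sch₀Of 𝓜 w I.univ x̄₁).X ≅ (sch₀Of 𝓜 w I.univ x̄₂).X` which is EXACT on the polarisations in dual-homomorphism form (`ε ≫ λ_{x̄₂} ≫ ε^∨ = λ_{x̄₁}`, `pol₀Of`∕`dual₀Of`), carries the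
level POINTS (`ε(σᵃ(x̄₁)) = σᵃ(x̄₂)`, `lvlPt₀Of`) and commutes with the `𝒪_F`-actions (`act₀Of`) gives `x̄₁ = x̄₂`.  PROOF = ONE TERM: ★ `exists_tupleRel_baseChange_comp_of_iso_of_points`
(tuple-iso of fibre iso at the two points `x̄ᵢ.left` of the special fibre `𝓨_s`, same first stage `π_s`) produces `tupleIsoAt (spPt 𝓜 w x̄₁) (spPt 𝓜 w x̄₂) I.univ I.act I.dual I.pol I.lvl`
(all three readers and `spPt` by `rfl`), and (L1′) `I.inj₀ z₁ z₂` concludes. [cite: MumfordFogartyKirwan1994, Ch. 7 §2 Definition 7.2 (p. 129) and Ch. 7 §3 Theorem 7.9 (p. 139)]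
[cite: RapoportSmithlingZhang2020Diagonal, §4.1 Thm. 4.1 p. 17] -/
theorem red₀Of_eq_of_structuredIso₀ (I : RGDInputsAt F ι₁ Jstar K₀ S hU7ₛ hJ hJu Fi Kc G 𝓜 w hw h𝓨 θ e)
    (z₁ z₂ : AlgPoints (S.M.obj Kc) (AlgebraicClosure (w.adicCompletion F)))
    (ε : (sch₀Of 𝓜 w I.univ (red₀Of S Kc 𝓜 w h𝓨 e z₁)).X ≅ (sch₀Of 𝓜 w I.univ (red₀Of S Kc 𝓜 w h𝓨 e z₂)).X) [IsMonHom ε.hom]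
    (hlam : ε.hom ≫ (pol₀Of 𝓜 w I.univ I.pol (red₀Of S Kc 𝓜 w h𝓨 e z₂)).lam ≫
        DualPair.dualIsogenyOver ε.hom (dual₀Of 𝓜 w I.univ I.dual (red₀Of S Kc 𝓜 w h𝓨 e z₁)) (dual₀Of 𝓜 w I.univ I.dual (red₀Of S Kc 𝓜 w h𝓨 e z₂)) =
      (pol₀Of 𝓜 w I.univ I.pol (red₀Of S Kc 𝓜 w h𝓨 e z₁)).lam)
    (hlvl : ∀ i : Fin I.g ⊕ Fin I.g → ZMod I.N,
      (AlgPoints.map ε.hom (lvlPt₀Of 𝓜 w I.univ I.lvl (red₀Of S Kc 𝓜 w h𝓨 e z₁) i) :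
          (fibre₀Of 𝓜 w I.univ (red₀Of S Kc 𝓜 w h𝓨 e z₂)).Points (geomResidueField w)) =
        lvlPt₀Of 𝓜 w I.univ I.lvl (red₀Of S Kc 𝓜 w h𝓨 e z₂) i)
    (hact : ∀ a : 𝓞 F, (act₀Of 𝓜 w I.univ I.act a (red₀Of S Kc 𝓜 w h𝓨 e z₁)).hom.hom.hom ≫ ε.hom =
      ε.hom ≫ (act₀Of 𝓜 w I.univ I.act a (red₀Of S Kc 𝓜 w h𝓨 e z₂)).hom.hom.hom) :
    red₀Of S Kc 𝓜 w h𝓨 e z₁ = red₀Of S Kc 𝓜 w h𝓨 e z₂ :=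
  I.inj₀ z₁ z₂ (exists_tupleRel_baseChange_comp_of_iso_of_points I.univ I.act I.dual I.pol I.lvl
    (pullback.fst (𝓜.localise w).total.hom (specResidueField w)) (red₀Of S Kc 𝓜 w h𝓨 e z₁).left (red₀Of S Kc 𝓜 w h𝓨 e z₂).left ε hlam hlvl hact)

/-- (C3a) The level row, ABSTRACT (no tower inside): if `τ ≫ r₁ = σ₁^{N′}`, `τ ≫ r₂ = σ₂^{N′}`, `r₁ ≫ ε = r₂` for a homomorphism `ε`, and `σ₁`, `σ₂` are `N`-torsion with
`gcd(N′, N) = 1`, then `σ₁ ≫ ε = σ₂` (`(σ₁ ≫ ε)^{N′} = σ₁^{N′} ≫ ε = τ ≫ r₂ = σ₂^{N′}`, Mathlib `MonObj.pow_comp`, then `eq_of_pow_eq_pow_of_coprime`).  In the (α)-currency it is read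
on POINTS `U := specOver κ̄ κ̄` (`AlgPoints.map r P = P ≫ r` by `rfl`).  (= LA6-p01 (g2) v5 :1707 VERBATIM — drop on paste if §3b has it.) [cite: MumfordFogartyKirwan1994, Ch. 7 §2 Definition 7.3 (p. 130)] -/
theorem comp_eq_of_pow_rows {T : Scheme} {U A X₁ X₂ : Over T} [MonObj X₁] [MonObj X₂] (r₁ : A ⟶ X₁) (r₂ : A ⟶ X₂) (ε : X₁ ⟶ X₂) [IsMonHom ε]
    (hε : r₁ ≫ ε = r₂) {τ : U ⟶ A} {σ₁ : U ⟶ X₁} {σ₂ : U ⟶ X₂} {N' N : ℕ} (hcop : N'.Coprime N)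
    (h₁ : τ ≫ r₁ = σ₁ ^ N') (h₂ : τ ≫ r₂ = σ₂ ^ N') (hσ₁ : σ₁ ^ N = 1) (hσ₂ : σ₂ ^ N = 1) : σ₁ ≫ ε = σ₂ := by
  have hpow : (σ₁ ≫ ε) ^ N' = σ₂ ^ N' := by rw [← MonObj.pow_comp, ← h₁, Category.assoc, hε, h₂]
  have htors : (σ₁ ≫ ε) ^ N = 1 := by rw [← MonObj.pow_comp, hσ₁, MonObj.one_comp]
  exact eq_of_pow_eq_pow_of_coprime hcop hpow htors hσ₂

set_option maxHeartbeats 400000 in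
set_option backward.isDefEq.respectTransparency false in
/-- **(C3α) `red₀Of_eq_of_common_source₀` — TWO REDUCTIONS OUT OF ONE SPECIAL ABELIAN SCHEME ONTO `A_{red₀ z₁}`, `A_{red₀ z₂}`, WITH THE SAME KERNEL, FORCE
`red₀ z₁ = red₀ z₂`** ((α)-currency twin of v5 (C3) `red₀Of_eq_of_common_source`; the rows are (C5) `exists_translReduction`'s (KER)∕(SIM)∕(ACT)∕(LVL) texts token for token,
issued twice out of a COMMON source `A`).  Let `A` be an abelian `κ̄(w)`-scheme with a dual pair `D_A`, a homomorphism `λ_A : A → Â`, an action `α : 𝓞 F → End A`, and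
`rᵢ : A → A_{x̄ᵢ} := (sch₀Of 𝓜 w I.univ x̄ᵢ).X` (`x̄ᵢ := red₀Of … zᵢ`) finite surjective homomorphisms with (KER) the SAME KERNEL on all `T`-points, (SIM) `rᵢ ≫ λ_{x̄ᵢ} ≫ rᵢ^∨ =
λ_A ≫ [m]` with ONE scalar `m`, (ACT) `α a ≫ rᵢ = rᵢ ≫ ι_{x̄ᵢ}(a)` (`act₀Of`), (LVL) a family of POINTS `τᵃ ∈ A(κ̄)` with `rᵢ(τᵃ) = σᵃ(x̄ᵢ)^{N′}` (`lvlPt₀Of`) for a scalar `N′`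
PRIME TO THE LEVEL `I.N`.  Then `x̄₁ = x̄₂`: ★ (TW) `roof_target_unique` gives `ε : A_{x̄₁} ⥲ A_{x̄₂}` with `r₁ ≫ ε = r₂`, exact on `λ`, intertwining the actions; `ε(σᵃ(x̄₁))` and
`σᵃ(x̄₂)` are `I.N`-torsion points (★ `restrictPt_section_pow_eq_one`; `I.univ ×_𝓨 𝓨_s` is commutative by `I.comm` + ★ `isCommMonObj_baseChange`) with the same `N′`-th power
`r₂(τᵃ)`, hence EQUAL ((C3a), Bezout); (C1α) concludes. [cite: MumfordAV1970, §7 Thm. 4 (p. 72); §23 (p. 231)]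
[cite: MumfordFogartyKirwan1994, Ch. 7 §2 Definition 7.2 (p. 129) and Ch. 7 §3 Theorem 7.9 (p. 139)] [cite: RapoportSmithlingZhang2020Diagonal, §4.1 Thm. 4.1 p. 17] -/
theorem red₀Of_eq_of_common_source₀ (I : RGDInputsAt F ι₁ Jstar K₀ S hU7ₛ hJ hJu Fi Kc G 𝓜 w hw h𝓨 θ e)
    (z₁ z₂ : AlgPoints (S.M.obj Kc) (AlgebraicClosure (w.adicCompletion F)))
    {A : AbelianSchemeOver (Spec (.of (geomResidueField w)))} (DA : A.DualPair) (lamA : A.X ⟶ DA.hat.X)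
    (α : 𝓞 F → (A.X ⟶ A.X))
    (r₁ : A.X ⟶ (sch₀Of 𝓜 w I.univ (red₀Of S Kc 𝓜 w h𝓨 e z₁)).X) [IsMonHom r₁] [IsFinite r₁.left] [Surjective r₁.left]
    (r₂ : A.X ⟶ (sch₀Of 𝓜 w I.univ (red₀Of S Kc 𝓜 w h𝓨 e z₂)).X) [IsMonHom r₂] [IsFinite r₂.left] [Surjective r₂.left]
    -- (KER) the same kernel on ALL `T`-points
    (hker : ∀ ⦃T : SchemeOver (geomResidueField w)⦄ (t : T ⟶ A.X), t ≫ r₁ = 1 ↔ t ≫ r₂ = 1)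
    -- (SIM) ONE scalar `m`
    (m : ℕ)
    (hr3₁ : r₁ ≫ (pol₀Of 𝓜 w I.univ I.pol (red₀Of S Kc 𝓜 w h𝓨 e z₁)).lam ≫
        DualPair.dualIsogenyOver r₁ DA (dual₀Of 𝓜 w I.univ I.dual (red₀Of S Kc 𝓜 w h𝓨 e z₁)) = lamA ≫ DA.hat.mulN m)
    (hr3₂ : r₂ ≫ (pol₀Of 𝓜 w I.univ I.pol (red₀Of S Kc 𝓜 w h𝓨 e z₂)).lam ≫
        DualPair.dualIsogenyOver r₂ DA (dual₀Of 𝓜 w I.univ I.dual (red₀Of S Kc 𝓜 w h𝓨 e z₂)) = lamA ≫ DA.hat.mulN m)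
    -- (ACT) through the common action `α`
    (hr4₁ : ∀ a : 𝓞 F, α a ≫ r₁ = r₁ ≫ (act₀Of 𝓜 w I.univ I.act a (red₀Of S Kc 𝓜 w h𝓨 e z₁)).hom.hom.hom)
    (hr4₂ : ∀ a : 𝓞 F, α a ≫ r₂ = r₂ ≫ (act₀Of 𝓜 w I.univ I.act a (red₀Of S Kc 𝓜 w h𝓨 e z₂)).hom.hom.hom)
    -- (LVL) level rows in POINTS form, power `N′` prime to `I.N`
    (τ : (Fin I.g ⊕ Fin I.g → ZMod I.N) → A.toAffine.toAbelianVariety.Points (geomResidueField w)) (N' : ℕ) (hN' : Nat.Coprime N' I.N)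
    (hr5₁ : ∀ i : Fin I.g ⊕ Fin I.g → ZMod I.N,
      (AlgPoints.map r₁ (τ i) : (fibre₀Of 𝓜 w I.univ (red₀Of S Kc 𝓜 w h𝓨 e z₁)).Points (geomResidueField w)) =
        lvlPt₀Of 𝓜 w I.univ I.lvl (red₀Of S Kc 𝓜 w h𝓨 e z₁) i ^ N')
    (hr5₂ : ∀ i : Fin I.g ⊕ Fin I.g → ZMod I.N,
      (AlgPoints.map r₂ (τ i) : (fibre₀Of 𝓜 w I.univ (red₀Of S Kc 𝓜 w h𝓨 e z₂)).Points (geomResidueField w)) =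
        lvlPt₀Of 𝓜 w I.univ I.lvl (red₀Of S Kc 𝓜 w h𝓨 e z₂) i ^ N') :
    red₀Of S Kc 𝓜 w h𝓨 e z₁ = red₀Of S Kc 𝓜 w h𝓨 e z₂ := by
  haveI := (pol₀Of 𝓜 w I.univ I.pol (red₀Of S Kc 𝓜 w h𝓨 e z₁)).isMonHom
  haveI := (pol₀Of 𝓜 w I.univ I.pol (red₀Of S Kc 𝓜 w h𝓨 e z₂)).isMonHom
  -- ★ (TW): the recognition isomorphism, exact on `λ`, intertwining, with `r₁ ≫ ε = r₂`
  obtain ⟨ε, hmon, hεq, -, hlam, hr4, -⟩ := roof_target_unique DA _ _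
    (pol₀Of 𝓜 w I.univ I.pol (red₀Of S Kc 𝓜 w h𝓨 e z₁)).nonempty_unitHatSlice_iso
    (pol₀Of 𝓜 w I.univ I.pol (red₀Of S Kc 𝓜 w h𝓨 e z₂)).nonempty_unitHatSlice_iso
    lamA _ _ r₁ r₂ m hker hr3₁ hr3₂
  haveI := hmon
  -- the level points `σᵃ(x̄ᵢ)` are `I.N`-torsion (`I.univ ×_𝓨 𝓨_s` is commutative)
  haveI : IsCommMonObj I.univ.X := I.comm
  haveI : IsCommMonObj (I.univ.baseChange (pullback.fst (𝓜.localise w).total.hom (specResidueField w))).X := isCommMonObj_baseChange _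
  have htors : ∀ (xbar : AlgPoints (𝓜.localise w).reductionAt (geomResidueField w)) (i : Fin I.g ⊕ Fin I.g → ZMod I.N),
      lvlPt₀Of 𝓜 w I.univ I.lvl xbar i ^ I.N = 1 := fun xbar i =>
    (I.lvl.baseChange (pullback.fst (𝓜.localise w).total.hom (specResidueField w))).restrictPt_section_pow_eq_one xbar.left i
  -- (C1α) with: `λ`-exactness from ★; level points by (C3a) READ ON POINTS; `ι`-intertwining from (ACT) via ★'s clause.
  -- HEAD-ROOM CURE (LA2-p04 (g8); proof body + one import line — statement, binders, docstring, budget line byte-identical): the level-row lambda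
  -- used ★ `comp_eq_of_pow_rows` (morphism currency) on the POINTS-currency rows `hr5ᵢ`∕`htors`, so `isDefEq` unfolded the `Points.instCommGroup (fibre₀Of …)`
  -- power against the `Hom.monoid` power of `(sch₀Of …).X` on the dock-sized carriers (154 k heartbeat units by import); ★ `map_eq_of_pow_rows_fibrePoints`
  -- (`Theorems/F0P6aSpecialFibrePointsRows`) is the same step with the carriers spelled as here and is fed its carriers `_ _ _` BY UNIFICATION from `r₁ r₂`
  -- (never re-typed, so the statement's own subterms are reused): 355 155 → 259 291 by import (88.8 % → 64.8 %; HOME probes `C3a.probe.v1…v4`).  The rest of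
  -- the closing cost is the ★-generic `Field.toCommRing` ∕ `Over` spelling of `roof_target_unique`'s rows against this statement's `AlgebraicClosure.instCommRing` ∕
  -- `SchemeOver` (`geomResidueField` is an `abbrev`), not curable proof-side.
  refine red₀Of_eq_of_structuredIso₀ I z₁ z₂ ε hlam (fun i => ?_) (fun a => hr4 (α a) _ _ (hr4₁ a) (hr4₂ a))
  exact map_eq_of_pow_rows_fibrePoints _ _ _ r₁ r₂ ε.hom hεq (τ i) hN' (hr5₁ i) (hr5₂ i) (htors _ i) (htors _ i)

end CommonSourceAlpha

section TranslWDα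

open scoped MonObj CategoryTheory.Obj

-- the frame of the D-line՚s `Letters` section VERBATIM
variable {F : Type} [Field F] [NumberField F] [IsCMField F] {ι₁ : F →+* ℂ}
    {Jstar : Matrix (Fin 2) (Fin 2) F}
    {K₀ : C5.OpenCompactSubgroup ↥(finAdelic ↥(maximalRealSubfield F) F (IsCMField.complexConj F) 2 Jstar)}
    {S : RecordSystemGS F Jstar ι₁ K₀} {hU7ₛ : S.HeckeTranslateDefinedOver}
    {hJ : (Jstar.map (IsCMField.complexConj F))ᵀ = Jstar} {hJu : IsUnit Jstar}
    {Fi : Type} [Field Fi] [Algebra F Fi] {Kc : C5.SmallLevel K₀} {G : Type} [Group G]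
    {𝓜 : IntegralModel (𝓞 F) F ((thickening F Fi).obj (S.M.obj Kc))}
    {w : HeightOneSpectrum (𝓞 F)} {hw : (IsCMField.complexConj F) • w ≠ w} {h𝓨 : (𝓜.localise w).IsSmoothProper 1}
    {θ : ActionOver (𝓜.localise w).total.hom ((Fi ≃ₐ[F] Fi) × G)}
    {e : Fi →ₐ[F] AlgebraicClosure (w.adicCompletion F)}

set_option maxHeartbeats 400000 in
set_option backward.isDefEq.respectTransparency false in
/-- **(C4α) `red₀Of_translΩ_eq_of_translReduction₀` — A REDUCED TRANSLATE DATUM MAKES THE SPECIAL TRANSLATE WELL DEFINED** ((α)-currency; the §3b head minus the roof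
reduction (C5)).  HYPOTHESIS = the conclusion of (C5) `exists_translReduction` VERBATIM (rows (KER)∕(SIM)∕(ACT)∕(LVL) in the `sch₀Of ∕ pol₀Of ∕ dual₀Of ∕ act₀Of ∕ lvlPt₀Of`
readers, ONE ideal `𝔞`, ONE `m`, ONE `N′` prime to `I.N`, for every `y`).  CONCLUSION: `red₀ y₁ = red₀ y₂ → red₀ (translΩ y₁) = red₀ (translΩ y₂)`.  PROOF: the datum at
`y₁` is MOVED to the special point `x̄ := red₀ y₂` along the equation binder `∀ x̄, red₀Of … y₁ = x̄ → <datum at x̄>` (`subst`; D-line lesson (F1): point equalities are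
carried by binders, never by unification inside the tower) — in (α)-currency the two reduced homs then have the LITERAL common source `(sch₀Of 𝓜 w I.univ x̄).X`; their
kernels are both `A_x̄[𝔞]` ((KER) twice, same `𝔞`), so (C3α) `red₀Of_eq_of_common_source₀` applies with `A := sch₀Of … x̄` and its own `dual₀Of ∕ pol₀Of ∕ act₀Of ∕ lvlPt₀Of`
(read off by unification). [cite: Liu2021, Prop. D.8 p. 135, p. 137] [cite: SerreTate1968, §1 Lemma 2] [cite: MumfordAV1970, §7 Thm. 4 (p. 72); §23 (p. 231)]
[cite: MumfordFogartyKirwan1994, Ch. 7 §2 Definition 7.2 (p. 129) and Ch. 7 §3 Theorem 7.9 (p. 139)] -/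
theorem red₀Of_translΩ_eq_of_translReduction₀ (I : RGDInputsAt F ι₁ Jstar K₀ S hU7ₛ hJ hJu Fi Kc G 𝓜 w hw h𝓨 θ e)
    (translΩ : AlgPoints (S.M.obj Kc) (AlgebraicClosure (w.adicCompletion F)) → AlgPoints (S.M.obj Kc) (AlgebraicClosure (w.adicCompletion F)))
    (𝔞 : Ideal (𝓞 F)) (m N' : ℕ) (hN' : Nat.Coprime N' I.N)
    (hdat : ∀ y : AlgPoints (S.M.obj Kc) (AlgebraicClosure (w.adicCompletion F)),
        ∃ (r : (sch₀Of 𝓜 w I.univ (red₀Of S Kc 𝓜 w h𝓨 e y)).X ⟶ (sch₀Of 𝓜 w I.univ (red₀Of S Kc 𝓜 w h𝓨 e (translΩ y))).X) (_ : IsMonHom r)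
          (_ : IsFinite r.left) (_ : Surjective r.left),
          (∀ ⦃T : SchemeOver (geomResidueField w)⦄ (t : T ⟶ (sch₀Of 𝓜 w I.univ (red₀Of S Kc 𝓜 w h𝓨 e y)).X),
              t ≫ r = 1 ↔ ∀ a ∈ 𝔞, t ≫ (act₀Of 𝓜 w I.univ I.act a (red₀Of S Kc 𝓜 w h𝓨 e y)).hom.hom.hom = 1) ∧
          r ≫ (pol₀Of 𝓜 w I.univ I.pol (red₀Of S Kc 𝓜 w h𝓨 e (translΩ y))).lam ≫
              DualPair.dualIsogenyOver r (dual₀Of 𝓜 w I.univ I.dual (red₀Of S Kc 𝓜 w h𝓨 e y)) (dual₀Of 𝓜 w I.univ I.dual (red₀Of S Kc 𝓜 w h𝓨 e (translΩ y))) =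
            (pol₀Of 𝓜 w I.univ I.pol (red₀Of S Kc 𝓜 w h𝓨 e y)).lam ≫ (dual₀Of 𝓜 w I.univ I.dual (red₀Of S Kc 𝓜 w h𝓨 e y)).hat.mulN m ∧
          (∀ a : 𝓞 F, (act₀Of 𝓜 w I.univ I.act a (red₀Of S Kc 𝓜 w h𝓨 e y)).hom.hom.hom ≫ r =
              r ≫ (act₀Of 𝓜 w I.univ I.act a (red₀Of S Kc 𝓜 w h𝓨 e (translΩ y))).hom.hom.hom) ∧
          (∀ i : Fin I.g ⊕ Fin I.g → ZMod I.N,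
              (AlgPoints.map r (lvlPt₀Of 𝓜 w I.univ I.lvl (red₀Of S Kc 𝓜 w h𝓨 e y) i) :
                  (fibre₀Of 𝓜 w I.univ (red₀Of S Kc 𝓜 w h𝓨 e (translΩ y))).Points (geomResidueField w)) =
                lvlPt₀Of 𝓜 w I.univ I.lvl (red₀Of S Kc 𝓜 w h𝓨 e (translΩ y)) i ^ N'))
    {y₁ y₂ : AlgPoints (S.M.obj Kc) (AlgebraicClosure (w.adicCompletion F))} (h : red₀Of S Kc 𝓜 w h𝓨 e y₁ = red₀Of S Kc 𝓜 w h𝓨 e y₂) :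
    red₀Of S Kc 𝓜 w h𝓨 e (translΩ y₁) = red₀Of S Kc 𝓜 w h𝓨 e (translΩ y₂) := by
  -- (1) move the `y₁`-datum to the common special point `x̄ := red₀ y₂` (equation binder + `subst`)
  have key : ∀ x : AlgPoints (𝓜.localise w).reductionAt (geomResidueField w), red₀Of S Kc 𝓜 w h𝓨 e y₁ = x →
      ∃ (r : (sch₀Of 𝓜 w I.univ x).X ⟶ (sch₀Of 𝓜 w I.univ (red₀Of S Kc 𝓜 w h𝓨 e (translΩ y₁))).X) (_ : IsMonHom r)
          (_ : IsFinite r.left) (_ : Surjective r.left),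
          (∀ ⦃T : SchemeOver (geomResidueField w)⦄ (t : T ⟶ (sch₀Of 𝓜 w I.univ x).X),
              t ≫ r = 1 ↔ ∀ a ∈ 𝔞, t ≫ (act₀Of 𝓜 w I.univ I.act a x).hom.hom.hom = 1) ∧
          r ≫ (pol₀Of 𝓜 w I.univ I.pol (red₀Of S Kc 𝓜 w h𝓨 e (translΩ y₁))).lam ≫
              DualPair.dualIsogenyOver r (dual₀Of 𝓜 w I.univ I.dual x) (dual₀Of 𝓜 w I.univ I.dual (red₀Of S Kc 𝓜 w h𝓨 e (translΩ y₁))) =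
            (pol₀Of 𝓜 w I.univ I.pol x).lam ≫ (dual₀Of 𝓜 w I.univ I.dual x).hat.mulN m ∧
          (∀ a : 𝓞 F, (act₀Of 𝓜 w I.univ I.act a x).hom.hom.hom ≫ r =
              r ≫ (act₀Of 𝓜 w I.univ I.act a (red₀Of S Kc 𝓜 w h𝓨 e (translΩ y₁))).hom.hom.hom) ∧
          (∀ i : Fin I.g ⊕ Fin I.g → ZMod I.N,
              (AlgPoints.map r (lvlPt₀Of 𝓜 w I.univ I.lvl x i) :
                  (fibre₀Of 𝓜 w I.univ (red₀Of S Kc 𝓜 w h𝓨 e (translΩ y₁))).Points (geomResidueField w)) =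
                lvlPt₀Of 𝓜 w I.univ I.lvl (red₀Of S Kc 𝓜 w h𝓨 e (translΩ y₁)) i ^ N') := by
    intro x hx
    subst hx
    exact hdat y₁
  obtain ⟨r₁, hr₁m, hr₁f, hr₁s, hk₁, hl₁, ha₁, hs₁⟩ := key _ h
  obtain ⟨r₂, hr₂m, hr₂f, hr₂s, hk₂, hl₂, ha₂, hs₂⟩ := hdat y₂
  haveI := hr₁m; haveI := hr₁f; haveI := hr₁s; haveI := hr₂m; haveI := hr₂f; haveI := hr₂s
  -- (2) two reductions out of ONE source `sch₀Of … (red₀ y₂)` with the same kernel `A[𝔞]`: (C3α)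
  exact red₀Of_eq_of_common_source₀ I (translΩ y₁) (translΩ y₂) _ _ _ r₁ r₂
    (fun T t => (hk₁ t).trans (hk₂ t).symm) m hl₁ hl₂ ha₁ ha₂ _ N' hN' hs₁ hs₂

set_option maxHeartbeats 400000 in
set_option backward.isDefEq.respectTransparency false in
/-- **§3b HEAD `red₀Of_translΩ_eq_of_red₀Of_eq` — THE SPECIAL TRANSLATE IS WELL DEFINED**: on the `e`-sheet, `red₀ (translΩ y)` depends only on `red₀ y` (LA2-plan (g0) deal
(S3B) 2026-09-02T04:28:54Z, the two-lift form of L2's `TranslWellDefLaw`; signature VERBATIM + the (O1) interim binder `hpN : Nat.Coprime I.pChar I.N` (LA2-plan (g2)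
07:18:27Z) LAST).  PROOF = (C5) `exists_translReduction` (§3a, LA6-p03 (g2); a SOCKET above until it lands) + (C4α). [cite: Liu2021, Prop. D.8 p. 135, p. 137]
[cite: SerreTate1968, §1 Lemma 2] -/
theorem red₀Of_translΩ_eq_of_red₀Of_eq (I : RGDInputsAt F ι₁ Jstar K₀ S hU7ₛ hJ hJu Fi Kc G 𝓜 w hw h𝓨 θ e)
    (translΩ : AlgPoints (S.M.obj Kc) (AlgebraicClosure (w.adicCompletion F)) → AlgPoints (S.M.obj Kc) (AlgebraicClosure (w.adicCompletion F)))
    (hroof₂ : RoofLink₂ I translΩ) (hpN : Nat.Coprime I.pChar I.N)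
    {y₁ y₂ : AlgPoints (S.M.obj Kc) (AlgebraicClosure (w.adicCompletion F))} (h : red₀Of S Kc 𝓜 w h𝓨 e y₁ = red₀Of S Kc 𝓜 w h𝓨 e y₂) :
    red₀Of S Kc 𝓜 w h𝓨 e (translΩ y₁) = red₀Of S Kc 𝓜 w h𝓨 e (translΩ y₂) := by
  obtain ⟨𝔞, m, N', hN', hdat⟩ := exists_translReduction I translΩ hroof₂ hpN
  exact red₀Of_translΩ_eq_of_translReduction₀ I translΩ 𝔞 m N' hN' hdat h

end TranslWDα

end Block_Tα

/-! ## §D6 — D6 SHEET — LA6-p01 (g3) `QuotQuotSheet.v1` 2673ec94b3615b33 (sections QuotQuotSheet, byte-identical) -/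

section Block_D6

open CategoryTheory CategoryTheory.Limits NumberField IsDedekindDomain MulAction AlgebraicGeometry
open scoped Matrix Polynomial Pointwise MonoidalCategory
open Literature.NumberTheory.GaloisRepresentations
open Literature.NumberTheory.Automorphic Literature.NumberTheory.Automorphic.UnitaryGroup
open Literature.AlgebraicGeometry.ShimuraVarieties.UnitaryCanonicalModel
open Literature.NumberTheory.Automorphic.Liu2021.AppendixC
open Literature.AlgebraicGeometry.Motives (AlgPoints IntegralModel SchemeOver thickening thickeningGalAction thickeningLift specOver)
open Literature.NumberTheory.DiophantineGeometry (geomResidueField specialFibreFunctor specResidueField)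
open Literature.AlgebraicGeometry.RelativeSpec (ActionOver)
open Literature.AlgebraicGeometry.AbelianSchemes Literature.AlgebraicGeometry.AbelianSchemes.AbelianSchemeOver
open Literature.AlgebraicGeometry.GroupSchemes.AffineGroupScheme (Alg quotIncl)
open Summit.HodgeConjecture.HodgeConjecture.Cruxes.HLiu418.F0P6aModuliDatumDefs
open Summit.HodgeConjecture.HodgeConjecture.Cruxes.HLiu418.F0P6aRGDAssembly
open Summit.HodgeConjecture.HodgeConjecture.Cruxes.HLiu418.F0P6aDatumOfInputs

section QuotQuotSheet

open scoped MonObj CategoryTheory.Obj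

-- Mathlib's `Over`/`Scheme` APIs are stated across semireducible wrappers (as in the ★ `GroupSchemes/*` files and the D-line).
set_option backward.isDefEq.respectTransparency false

-- the frame of the D-line՚s `Letters` section VERBATIM
variable {F : Type} [Field F] [NumberField F] [IsCMField F] {ι₁ : F →+* ℂ}
    {Jstar : Matrix (Fin 2) (Fin 2) F}
    {K₀ : C5.OpenCompactSubgroup ↥(finAdelic ↥(maximalRealSubfield F) F (IsCMField.complexConj F) 2 Jstar)}
    {S : RecordSystemGS F Jstar ι₁ K₀} {hU7ₛ : S.HeckeTranslateDefinedOver}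
    {hJ : (Jstar.map (IsCMField.complexConj F))ᵀ = Jstar} {hJu : IsUnit Jstar}
    {Fi : Type} [Field Fi] [Algebra F Fi] {Kc : C5.SmallLevel K₀} {G : Type} [Group G]
    {𝓜 : IntegralModel (𝓞 F) F ((thickening F Fi).obj (S.M.obj Kc))}
    {w : HeightOneSpectrum (𝓞 F)} {hw : (IsCMField.complexConj F) • w ≠ w} {h𝓨 : (𝓜.localise w).IsSmoothProper 1}
    {θ : ActionOver (𝓜.localise w).total.hom ((Fi ≃ₐ[F] Fi) × G)}
    {e : Fi →ₐ[F] AlgebraicClosure (w.adicCompletion F)}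

end QuotQuotSheet

end Block_D6

end Summit.HodgeConjecture.HodgeConjecture.Cruxes.HLiu418.F0P6aLineSpecialisation

end
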